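/-
Copyright (c) 2026 the pub-hodgecm-mathlib formalisation cell (harness21).  Prover seat hodgecm-mathlib-F0P3-p01 (g31), «(D-RAM) FOUR-FRAME» road of crux H413, line LH4,
unit U3_Laws, κ-STAGE B brick κG₂ «G₁-κ» (dealer LH4-plan (g11) WORD #52 (a); letters LH4-p09 (g3), κ owner LH4-p05 (g3)).  FILE κG₂-C1 — THE DECOMPOSITION (type 2).  2026-09-04.
-/
import Summits.HodgeConjecture.HodgeConjecture.Theorems.F0P3cDyRamDiagonalKappaGluedClassForm          -- ★ κG-A1 p856611 (LH4-p09 (g3)): `kappaCount_mapGL_diagGLUnits`; brings ★ KappaCountDefs∕Eval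
import Summits.HodgeConjecture.HodgeConjecture.Theorems.F0P3cDyRamDiagonalGluedFootContributionCorner   -- ★ p856276 (this seat): `mapGL_latt_glued_corner_eq_iff_kappa`; brings ★ p856228 BoxCountCorner, ★ p856198, ★ p856176, ★ p856076
import Summits.HodgeConjecture.HodgeConjecture.Theorems.F0P3cDyRamDiagonalPairReindex                  -- ★ (O2a) p855745 (LH4-p04 (g2)): `mapGL_mapGL_diagGLUnits_eq_iff`
import Summits.HodgeConjecture.HodgeConjecture.Theorems.F0P3cDyRamDiagonalStratumTools                  -- ★ (LH4-p13 (g2)): `finsum_mem_eq_ncard_mul`, `stabiliserWeight_mapGL_diagGLUnits`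
import Mathlib.Data.Set.Card.Arithmetic
import HarnessLib

/-!
# Crux `H413`, κ-STAGE B brick κG₂, FILE C1: the κ-census of the glued TYPE-2 (R)-family `G₁(2ρ+1, 2t)`, decomposed over the unit-torus orbits of the fixed class representatives

Cell `hodgecm-mathlib` (D-0151), FLOOR 0, crux item H413 = `stmt-HodgeConjecture-24833`; lane `--supports stmt-HodgeConjecture-24833 --as helper` (count-neutral).  THEOREMS ONLY
(no `def`, no instance, no notation, no `sorry`).  The type-2 twin of ★ p856677 `F0P3cDyRamDiagonalKappaGluedDecomposition` (LH4-p09 (g3)), value-free: for the glued type-2 frames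
`V(x,ζ,y″) = (1 0 0; x ϖ^ρ 0; xζ+y″ ϖ^ρζ ϖ^{2ρ+2t+1})` satisfying the type-2 criterion (R) `∃ f = σf, |ζσy″ − σx·f| ≤ |ϖ|^{ρ+2t}` (★ p856270 LH4-p09 (g2) ⟺ type-2 polarisable; ★ p856228
`criterionR_iff_exists_fixed_kappa` ⟺ `κ = y″∕(xζ)` is `𝔭^{ρ+2t}`-close to a fixed element), the family is the disjoint union of the `𝒯`-orbits of the STABLE representatives `V₀(g) = V(1,1,g)`,
`g ∈ R` a complete irredundant system of the fixed `g`, `|g| = |ϖ|^{2t}`, modulo `𝔭^{ρ+2t}` (★ p856228 `exists_mem_unitTorus_latt_glued_corner_eq_mapGL`, `v_kappa_sub_le_of_latt_glued_corner_eq`;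
★ `mapGL_mapGL_diagGLUnits_eq_iff`); `kappaCount σ ϖ 2 i` and `stabiliserWeight` are orbit constants (★ κG-A1 `kappaCount_mapGL_diagGLUnits` — any `tv`; ★ `stabiliserWeight_mapGL_diagGLUnits`);
orbit size ★ p856198 `((q−1)q^{ρ+2t})((q−1)q^{2ρ})`, weight ★ p856076 `(((q−1)q^{⌈(ρ+2t+1)∕2⌉−1})((q−1)q^{ρ}))⁻¹`, so each orbit has MASS `q^{2ρ+2t+1−⌈(ρ+2t+1)∕2⌉} = q^{ρ+⌈ρ∕2⌉+t}`
(`orbit_mass_two_eq_pow`; = `q^{ρ%2}` × the type-0 mass of ★ p856677).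
* §1 `orbit_mass_two_eq_pow`.
* §2 HEAD **`finsum_kappaCount_two_mul_stabiliserWeight_glued_eq`**: `Σᶠ_{(R)-glued stable type 2} κ_i·w = q^{2ρ+2t+1−⌈(ρ+2t+1)∕2⌉} · Σ_{g ∈ R, T·latt V₀(g) = latt V₀(g)} κ_i(latt V₀(g))`
  (`κ_i = kappaCount σ ϖ 2 i`), `T = diag(s)` any diagonal, no regime assumption.
* §3 the stable representatives by regime: `mapGL_latt_glued_rep_two_of_depths` (tube `2ρ+2t+1 ≤ n₁`, `2ρ+1 ≤ n₂`, `ρ ≤ n₃`: all stable, ★ p856176) and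
  `mapGL_latt_glued_rep_two_iff` (glue foot `n₂ = n₃ = m`, `n₁ = m+2t`, `ρ+1 ≤ m ≤ 2ρ+2t+1`: stable ⟺ `|g + (β−1)∕(α−1)| ≤ |ϖ|^{2ρ+2t+1−m}`, ★ p856276).
HONEST LABEL.  Count-neutral (`--supports`); the κ-laws stay PROVER TARGETS; `HC_CM` is proved only modulo the 7 printed citations (2 remaining named inputs: hLiu418 =
`stmt-HodgeConjecture-24832`, h413 = `stmt-HodgeConjecture-24833`) until rung 0 closes.

## References
* [Kottwitz1986BaseChangeUnits] R. E. Kottwitz, *Base change for unit elements of Hecke algebras*, Compositio Math. 60 (1986), §1 pp. 240–241 (fixed-lattice counts via torus orbits).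
* [LanglandsShelstad1987] R. P. Langlands, D. Shelstad, *On the definition of transfer factors*, Math. Ann. 278 (1987), §3 (the κ-signs).
* [Rogawski1990] J. D. Rogawski, *Automorphic Representations of Unitary Groups in Three Variables*, Ann. of Math. Stud. 123 (1990), §4.9 Prop. 4.9.1 (a) p. 55.
-/

set_option autoImplicit false

noncomputable section

namespace Summit.HodgeConjecture.HodgeConjecture.Cruxes.H413.F0P3cDyRamDiagonalKappaGluedDecompositionTwo

open Matrix WithZero
open Literature.NumberTheory.Automorphic Literature.NumberTheory.Automorphic.HermitianLattice
open Literature.NumberTheory.Automorphic.UnitaryLatticeTree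
open Summit.HodgeConjecture.HodgeConjecture.Cruxes.H413.F0P3cDyRamDiagonalTorusDefs
open Summit.HodgeConjecture.HodgeConjecture.Cruxes.H413.F0P3cDyRamDiagonalKappaCountDefs
open Summit.HodgeConjecture.HodgeConjecture.Cruxes.H413.F0P3cDyRamDiagonalKappaGluedClassForm (kappaCount_mapGL_diagGLUnits)
open Summit.HodgeConjecture.HodgeConjecture.Cruxes.H413.F0P3cDyRamDiagonalGluedTorusOrbits (exists_gl_coe_eq_glued exists_glued_of_mem_orbit)
open Summit.HodgeConjecture.HodgeConjecture.Cruxes.H413.F0P3cDyRamDiagonalGluedStabiliserIndex (ne_zero_and_v_lt_one_of_v_eq_exp)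
open Summit.HodgeConjecture.HodgeConjecture.Cruxes.H413.F0P3cDyRamDiagonalGluedStabiliserIndexCorner (stabiliserWeight_latt_glued_corner_eq)
open Summit.HodgeConjecture.HodgeConjecture.Cruxes.H413.F0P3cDyRamDiagonalGluedStabiliserIndexFullCorner (ncard_unitTorus_orbit_latt_glued_corner_eq)
open Summit.HodgeConjecture.HodgeConjecture.Cruxes.H413.F0P3cDyRamDiagonalGluedBoxCountCorner
  (exists_mem_unitTorus_latt_glued_corner_eq_mapGL v_kappa_sub_le_of_latt_glued_corner_eq criterionR_iff_exists_fixed_kappa)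
open Summit.HodgeConjecture.HodgeConjecture.Cruxes.H413.F0P3cDyRamDiagonalGluedStabilityCorner (mapGL_latt_hnf_glued_corner_eq_of_depths)
open Summit.HodgeConjecture.HodgeConjecture.Cruxes.H413.F0P3cDyRamDiagonalGluedFootContributionCorner (mapGL_latt_glued_corner_eq_iff_kappa)
open Summit.HodgeConjecture.HodgeConjecture.Cruxes.H413.F0P3cDyRamDiagonalPairReindex (mapGL_mapGL_diagGLUnits_eq_iff)
open Summit.HodgeConjecture.HodgeConjecture.Cruxes.H413.F0P3cDyRamDiagonalStratumTools (finsum_mem_eq_ncard_mul stabiliserWeight_mapGL_diagGLUnits)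
open scoped Valued WithZero Matrix MatrixGroups

variable {K : Type} [Field K] [Valued K ℤᵐ⁰]

/-! ## §1  The mass of one orbit (type 2) -/

/-- **`|𝒯-orbit| · weight = q^{2ρ + 2t + 1 − ⌈(ρ+2t+1)∕2⌉}`** on the glued type-2 stratum `G₁(2ρ+1, 2t)` (`ρ ≥ 1`, `q ≥ 2`): `((q−1)q^{ρ+2t})((q−1)q^{2ρ})` members (★ p856198 at `e = 1`) of
weight `(((q−1)q^{⌈(ρ+2t+1)∕2⌉−1})((q−1)q^{ρ}))⁻¹` (★ p856076 at `e = 1`); the letters are those two lemmas' outputs at `s := 2t`, `e := 1`. [cite: Kottwitz1986BaseChangeUnits, §1 pp. 240–241] -/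
theorem orbit_mass_two_eq_pow {q ρ : ℕ} (hq : 1 < q) (hρ : 1 ≤ ρ) (t : ℕ) :
    ((((q - 1) * q ^ (ρ + 2 * t + 1 - 1)) * ((q - 1) * q ^ (2 * ρ + 1 - 1)) : ℕ) : ℚ) *
        ((((q - 1) * q ^ ((ρ + 2 * t + 1 + 1) / 2 - 1)) * ((q - 1) * q ^ ((2 * ρ + 1 + 1) / 2 - 1)) : ℕ) : ℚ)⁻¹ =
      (q : ℚ) ^ (2 * ρ + 2 * t + 1 - (ρ + 2 * t + 2) / 2) := by
  have hq1 : ((q : ℚ) - 1) ≠ 0 := sub_ne_zero.2 (by exact_mod_cast hq.ne')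
  have hq0 : (q : ℚ) ≠ 0 := by exact_mod_cast (by omega : q ≠ 0)
  have hden : ((((q - 1) * q ^ ((ρ + 2 * t + 1 + 1) / 2 - 1)) * ((q - 1) * q ^ ((2 * ρ + 1 + 1) / 2 - 1)) : ℕ) : ℚ) ≠ 0 := by
    push_cast [Nat.cast_sub hq.le]
    exact mul_ne_zero (mul_ne_zero hq1 (pow_ne_zero _ hq0)) (mul_ne_zero hq1 (pow_ne_zero _ hq0))
  rw [mul_inv_eq_iff_eq_mul₀ hden, Nat.add_sub_cancel, Nat.add_sub_cancel]
  push_cast [Nat.cast_sub hq.le]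
  have hexp : (ρ + 2 * t) + (2 * ρ) = (2 * ρ + 2 * t + 1 - (ρ + 2 * t + 2) / 2) + (((ρ + 2 * t + 1 + 1) / 2 - 1) + ((2 * ρ + 1 + 1) / 2 - 1)) := by
    omega
  have key : (q : ℚ) ^ (ρ + 2 * t) * (q : ℚ) ^ (2 * ρ) =
      (q : ℚ) ^ (2 * ρ + 2 * t + 1 - (ρ + 2 * t + 2) / 2) * ((q : ℚ) ^ ((ρ + 2 * t + 1 + 1) / 2 - 1) * (q : ℚ) ^ ((2 * ρ + 1 + 1) / 2 - 1)) := by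
    rw [← pow_add, ← pow_add, ← pow_add, hexp]
  linear_combination ((q : ℚ) - 1) ^ 2 * key

/-! ## §2  The decomposition of the κ-census of the glued stable type-2 (R)-family -/

open Classical in
/-- **THE κ-CENSUS OF THE GLUED STABLE TYPE-2 (R)-FAMILY, BY CLASSES**: for `T = diag(s)` (no regime assumption), involution letters, `ρ ≥ 1`, a complete irredundant system `R`
(Finset) of the fixed elements of valuation `|ϖ|^{2t}` modulo `𝔭^{ρ+2t}`, and reference frames `V₀ g = V(1, 1, g)` at the type-2 corner `ϖ^{2ρ+2t+1}`:
`Σᶠ_{M ∈ {latt V(x,ζ,y″) : T·M = M, (R)}} κ_i(M)·w(M) = q^{2ρ + 2t + 1 − ⌈(ρ+2t+1)∕2⌉} · Σ_{g ∈ R, T·latt V₀(g) = latt V₀(g)} κ_i(latt V₀(g))` (`κ_i = kappaCount σ ϖ 2 i`).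
[cite: Kottwitz1986BaseChangeUnits, §1 pp. 240–241] [cite: LanglandsShelstad1987, §3] [cite: Rogawski1990, §4.9 Prop. 4.9.1 (a) p. 55] -/
theorem finsum_kappaCount_two_mul_stabiliserWeight_glued_eq {σ : K →+* K} (hσ : ∀ a, σ (σ a) = a) (hvσ : ∀ a, Valued.v (σ a) = Valued.v a)
    (hfix : ∀ x : K, σ x = x → x ≠ 0 → ∃ n : ℤ, Valued.v x = exp (2 * n)) {ϖ : K} (hϖ : Valued.v ϖ = exp (-1 : ℤ))
    {d : ℕ} (hd : Valued.v (ϖ - σ ϖ) = Valued.v ϖ ^ d) [Finite 𝓀[K]]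
    {s : Fin 3 → K} (T : GL (Fin 3) K) (hT : (T : Matrix (Fin 3) (Fin 3) K) = Matrix.diagonal s)
    (ρ t : ℕ) (hρ : 1 ≤ ρ) (R : Finset K) (hR1 : ∀ g ∈ R, σ g = g ∧ Valued.v g = Valued.v ϖ ^ (2 * t))
    (hR2 : ∀ f : K, σ f = f → Valued.v f = Valued.v ϖ ^ (2 * t) → ∃ g ∈ R, Valued.v (f - g) ≤ Valued.v ϖ ^ (ρ + 2 * t))
    (hR3 : ∀ g ∈ R, ∀ g' ∈ R, Valued.v (g - g') ≤ Valued.v ϖ ^ (ρ + 2 * t) → g = g')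
    (V₀ : K → GL (Fin 3) K) (hV₀ : ∀ g, (V₀ g : Matrix (Fin 3) (Fin 3) K) = !![1, 0, 0; 1, ϖ ^ ρ, 0; 1 * 1 + g, ϖ ^ ρ * 1, ϖ ^ (2 * ρ + 2 * t + 1)]) (i : Fin 3) :
    ∑ᶠ M ∈ {M : Submodule 𝒪[K] (Fin 3 → K) | ∃ x ζ y'' : K, Valued.v x = 1 ∧ Valued.v ζ = 1 ∧ Valued.v y'' = Valued.v ϖ ^ (2 * t) ∧
        M = latt (!![1, 0, 0; x, ϖ ^ ρ, 0; x * ζ + y'', ϖ ^ ρ * ζ, ϖ ^ (2 * ρ + 2 * t + 1)] : Matrix (Fin 3) (Fin 3) K) ∧ mapGL T M = M ∧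
        ∃ f : K, σ f = f ∧ Valued.v (ζ * σ y'' - σ x * f) ≤ Valued.v ϖ ^ (ρ + 2 * t)},
        (kappaCount σ ϖ 2 i M : ℚ) * stabiliserWeight σ M =
      (Nat.card 𝓀[K] : ℚ) ^ (2 * ρ + 2 * t + 1 - (ρ + 2 * t + 2) / 2) *
        ∑ g ∈ R.filter (fun g => mapGL T (latt (V₀ g : Matrix (Fin 3) (Fin 3) K)) = latt (V₀ g : Matrix (Fin 3) (Fin 3) K)),
          (kappaCount σ ϖ 2 i (latt (V₀ g : Matrix (Fin 3) (Fin 3) K)) : ℚ) := by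
  obtain ⟨hϖ0, hϖ1⟩ := ne_zero_and_v_lt_one_of_v_eq_exp hϖ
  set Orb : K → Set (Submodule 𝒪[K] (Fin 3 → K)) := fun g => {M | ∃ u ∈ unitTorus K 3, M = mapGL (diagGLUnits u) (latt (V₀ g : Matrix (Fin 3) (Fin 3) K))}
    with hOrb
  set R' : Finset K := R.filter (fun g => mapGL T (latt (V₀ g : Matrix (Fin 3) (Fin 3) K)) = latt (V₀ g : Matrix (Fin 3) (Fin 3) K)) with hR'
  have hlt : Valued.v ϖ ^ (ρ + 2 * t) < Valued.v ϖ ^ (2 * t) := by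
    rw [pow_add, mul_comm]
    exact mul_lt_of_lt_one_right (pow_pos ((Valuation.pos_iff _).2 hϖ0) _) (pow_lt_one₀ zero_le hϖ1 (by omega))
  have h11 : Valued.v (1 : K) = 1 := map_one _
  have e21 : 2 * ρ + 2 * t + 1 = 2 * ρ + (2 * t) + 1 := rfl
  -- the set identity: the family is the union of the orbits of the STABLE representatives
  have hset : {M : Submodule 𝒪[K] (Fin 3 → K) | ∃ x ζ y'' : K, Valued.v x = 1 ∧ Valued.v ζ = 1 ∧ Valued.v y'' = Valued.v ϖ ^ (2 * t) ∧
        M = latt (!![1, 0, 0; x, ϖ ^ ρ, 0; x * ζ + y'', ϖ ^ ρ * ζ, ϖ ^ (2 * ρ + 2 * t + 1)] : Matrix (Fin 3) (Fin 3) K) ∧ mapGL T M = M ∧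
        ∃ f : K, σ f = f ∧ Valued.v (ζ * σ y'' - σ x * f) ≤ Valued.v ϖ ^ (ρ + 2 * t)} = ⋃ g ∈ (R' : Set K), Orb g := by
    ext M
    simp only [Set.mem_setOf_eq, Set.mem_iUnion, hOrb, hR', Finset.coe_filter, exists_prop]
    constructor
    · rintro ⟨x, ζ, y'', hx, hζ, hy'', rfl, hstab, hR⟩
      obtain ⟨f, hσf, hκf⟩ := (criterionR_iff_exists_fixed_kappa hσ hvσ hx hζ y'' _).1 hR
      have hvκ : Valued.v (y'' / (x * ζ)) = Valued.v ϖ ^ (2 * t) := by rw [map_div₀, map_mul, hx, hζ, mul_one, div_one, hy'']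
      have hvf : Valued.v f = Valued.v ϖ ^ (2 * t) := by
        have h := Valuation.map_sub_eq_of_lt_left Valued.v (hvκ ▸ hκf.trans_lt hlt : Valued.v (y'' / (x * ζ) - f) < Valued.v (y'' / (x * ζ)))
        rw [← hvκ, ← h, sub_sub_cancel]
      obtain ⟨g, hg, hfg⟩ := hR2 f hσf hvf
      have hκg : Valued.v (y'' / (x * ζ) - g) ≤ Valued.v ϖ ^ (ρ + 2 * t) := by
        rw [show y'' / (x * ζ) - g = (y'' / (x * ζ) - f) + (f - g) by ring]
        exact Valuation.map_add_le _ hκf hfg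
      obtain ⟨u, hu, hM⟩ := exists_mem_unitTorus_latt_glued_corner_eq_mapGL hϖ0 ρ (2 * t) hx hζ hy'' (hR1 g hg).2 hκg (pow_ne_zero _ hϖ0) (V₀ g) (hV₀ g)
      refine ⟨g, ⟨hg, ?_⟩, u, hu, hM⟩
      rw [hM] at hstab
      exact (mapGL_mapGL_diagGLUnits_eq_iff u T hT _).1 hstab
    · rintro ⟨g, ⟨hg, hgst⟩, u, hu, rfl⟩
      obtain ⟨x', ζ', y₁, hx', hζ', hy₁, hκ, hM⟩ := exists_glued_of_mem_orbit u hu g (ϖ ^ ρ) (ϖ ^ (2 * ρ + 2 * t + 1)) (V₀ g) (hV₀ g)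
      have hy₁' : Valued.v y₁ = Valued.v ϖ ^ (2 * t) := by rw [hy₁, (hR1 g hg).2]
      refine ⟨x', ζ', y₁, hx', hζ', hy₁', hM, ?_, ?_⟩
      · exact (mapGL_mapGL_diagGLUnits_eq_iff u T hT _).2 hgst
      · exact (criterionR_iff_exists_fixed_kappa hσ hvσ hx' hζ' y₁ _).2 ⟨g, (hR1 g hg).1, by rw [hκ, sub_self, map_zero]; exact zero_le⟩
  -- pairwise disjoint orbits
  have hdisj : (R' : Set K).PairwiseDisjoint Orb := by
    intro g hg g' hg' hne
    have hgR : g ∈ R := (Finset.mem_filter.1 hg).1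
    have hg'R : g' ∈ R := (Finset.mem_filter.1 hg').1
    rw [Function.onFun, Set.disjoint_left]
    intro M hM hM'
    apply hne
    simp only [hOrb, Set.mem_setOf_eq] at hM hM'
    obtain ⟨u, hu, rfl⟩ := hM
    obtain ⟨u', hu', hMM⟩ := hM'
    obtain ⟨x, ζ, y, hx, hζ, hy, hκ, h1⟩ := exists_glued_of_mem_orbit u hu g (ϖ ^ ρ) (ϖ ^ (2 * ρ + 2 * t + 1)) (V₀ g) (hV₀ g)
    obtain ⟨x', ζ', y', hx', hζ', -, hκ', h2⟩ := exists_glued_of_mem_orbit u' hu' g' (ϖ ^ ρ) (ϖ ^ (2 * ρ + 2 * t + 1)) (V₀ g') (hV₀ g')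
    have hyv : Valued.v y = Valued.v ϖ ^ (2 * t) := by rw [hy, (hR1 g hgR).2]
    have hv := v_kappa_sub_le_of_latt_glued_corner_eq hϖ0 hϖ1.le ρ (2 * t) 1 hx hζ hyv hx' hζ' (h1.symm.trans (hMM.trans h2))
    rw [hκ, hκ'] at hv
    exact hR3 g hgR g' hg'R hv
  -- orbit sizes, the weight and the κ-count along an orbit
  have hN : ∀ g ∈ (R' : Set K), (Orb g).ncard = ((Nat.card 𝓀[K] - 1) * Nat.card 𝓀[K] ^ (ρ + 2 * t + 1 - 1)) * ((Nat.card 𝓀[K] - 1) * Nat.card 𝓀[K] ^ (2 * ρ + 1 - 1)) :=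
    fun g hg => ncard_unitTorus_orbit_latt_glued_corner_eq hϖ hρ (2 * t) 1 h11 h11 (by rw [(hR1 g (Finset.mem_filter.1 hg).1).2]) (V₀ g) (by rw [hV₀ g])
  have hq : 1 < Nat.card 𝓀[K] := Finite.one_lt_card
  have hN0 : ((Nat.card 𝓀[K] - 1) * Nat.card 𝓀[K] ^ (ρ + 2 * t + 1 - 1)) * ((Nat.card 𝓀[K] - 1) * Nat.card 𝓀[K] ^ (2 * ρ + 1 - 1)) ≠ 0 :=
    mul_ne_zero (mul_ne_zero (by omega) (pow_ne_zero _ (by omega))) (mul_ne_zero (by omega) (pow_ne_zero _ (by omega)))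
  have hfinOrb : ∀ g ∈ (R' : Set K), (Orb g).Finite := fun g hg => Set.finite_of_ncard_ne_zero (by rw [hN g hg]; exact hN0)
  have hw : ∀ g ∈ (R' : Set K), ∀ M ∈ Orb g, (kappaCount σ ϖ 2 i M : ℚ) * stabiliserWeight σ M =
      (kappaCount σ ϖ 2 i (latt (V₀ g : Matrix (Fin 3) (Fin 3) K)) : ℚ) *
        ((((Nat.card 𝓀[K] - 1) * Nat.card 𝓀[K] ^ ((ρ + 2 * t + 1 + 1) / 2 - 1)) * ((Nat.card 𝓀[K] - 1) * Nat.card 𝓀[K] ^ ((2 * ρ + 1 + 1) / 2 - 1)) : ℕ) : ℚ)⁻¹ := by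
    rintro g hg M ⟨u, -, rfl⟩
    have hgR : g ∈ R := (Finset.mem_filter.1 hg).1
    rw [kappaCount_mapGL_diagGLUnits hσ, stabiliserWeight_mapGL_diagGLUnits,
      stabiliserWeight_latt_glued_corner_eq hσ hvσ hfix hϖ hd hρ (2 * t) 1 h11 h11 (hR1 g hgR).2 (V₀ g) (hV₀ g) (hR1 g hgR).1
        (by rw [map_one, (hR1 g hgR).1, one_mul, sub_self, map_zero]; exact zero_le)]
  have hR'fin : (R' : Set K).Finite := R'.finite_toSet
  rw [hset, finsum_mem_biUnion hdisj hR'fin hfinOrb,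
    finsum_mem_congr rfl (fun g hg => finsum_mem_eq_ncard_mul (hfinOrb g hg) _ _ (hw g hg)),
    finsum_mem_congr rfl (fun g hg => by rw [hN g hg]), finsum_mem_coe_finset, ← orbit_mass_two_eq_pow hq hρ t, Finset.mul_sum]
  refine Finset.sum_congr rfl fun g _ => ?_
  ring

/-! ## §3  The stable representatives, by regime (type 2) -/

/-- **ON THE TYPE-2 TUBE EVERY REPRESENTATIVE IS STABLE** (`2ρ + 2t + 1 ≤ n₁`, `2ρ + 1 ≤ n₂`, `ρ ≤ n₃`; ★ p856176). [cite: Kottwitz1986BaseChangeUnits, §1 pp. 240–241] -/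
theorem mapGL_latt_glued_rep_two_of_depths {ϖ : K} (hϖ0 : ϖ ≠ 0) (hϖ1 : Valued.v ϖ ≤ 1) {α β : K} (hα : Valued.v α = 1) (hβ : Valued.v β = 1)
    (T : GL (Fin 3) K) (hT : (T : Matrix (Fin 3) (Fin 3) K) = Matrix.diagonal ![α, β, 1]) {n₁ n₂ n₃ : ℕ}
    (h₁ : Valued.v (β - 1) = Valued.v ϖ ^ n₁) (h₂ : Valued.v (α - 1) = Valued.v ϖ ^ n₂) (h₃ : Valued.v (β - α) = Valued.v ϖ ^ n₃)
    {ρ t : ℕ} (hρ₁ : 2 * ρ + 2 * t + 1 ≤ n₁) (hρ₂ : 2 * ρ + 1 ≤ n₂) (hρ₃ : ρ ≤ n₃) {g : K} (hg : Valued.v g = Valued.v ϖ ^ (2 * t))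
    (V : GL (Fin 3) K) (hV : (V : Matrix (Fin 3) (Fin 3) K) = !![1, 0, 0; 1, ϖ ^ ρ, 0; 1 * 1 + g, ϖ ^ ρ * 1, ϖ ^ (2 * ρ + 2 * t + 1)]) :
    mapGL T (latt (V : Matrix (Fin 3) (Fin 3) K)) = latt (V : Matrix (Fin 3) (Fin 3) K) :=
  mapGL_latt_hnf_glued_corner_eq_of_depths hϖ0 hϖ1 hα hβ T hT h₁ h₂ h₃ ρ (2 * t) 1 hρ₁ hρ₂ hρ₃ (x := 1) (ζ := 1) (by simp) (by simp) hg V hV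

/-- **ON THE TYPE-2 GLUE FOOT A REPRESENTATIVE IS STABLE IFF ITS CLASS IS NEAR `−(β−1)∕(α−1)`**: `T·latt V(1,1,g) = latt V(1,1,g) ⟺ |g + (β−1)∕(α−1)| ≤ |ϖ|^{2ρ+2t+1−m}`
(`ρ + 1 ≤ m ≤ 2ρ + 2t + 1`; ★ p856276 at `x = ζ = 1`, `κ = g`, `e = 1`). [cite: Kottwitz1986BaseChangeUnits, §1 pp. 240–241] -/
theorem mapGL_latt_glued_rep_two_iff {ϖ : K} (hϖ : Valued.v ϖ = exp (-1 : ℤ)) {α β : K} (hα : Valued.v α = 1) (hβ : Valued.v β = 1)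
    (T : GL (Fin 3) K) (hT : (T : Matrix (Fin 3) (Fin 3) K) = Matrix.diagonal ![α, β, 1]) {m t : ℕ}
    (h₁ : Valued.v (β - 1) = Valued.v ϖ ^ (m + 2 * t)) (h₂ : Valued.v (α - 1) = Valued.v ϖ ^ m) (h₃ : Valued.v (β - α) = Valued.v ϖ ^ m)
    {ρ : ℕ} (hρm : ρ + 1 ≤ m) (hm : m ≤ 2 * ρ + 2 * t + 1) (g : K) (V : GL (Fin 3) K)
    (hV : (V : Matrix (Fin 3) (Fin 3) K) = !![1, 0, 0; 1, ϖ ^ ρ, 0; 1 * 1 + g, ϖ ^ ρ * 1, ϖ ^ (2 * ρ + 2 * t + 1)]) :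
    mapGL T (latt (V : Matrix (Fin 3) (Fin 3) K)) = latt (V : Matrix (Fin 3) (Fin 3) K) ↔
      Valued.v (g + (β - 1) / (α - 1)) ≤ Valued.v ϖ ^ (2 * ρ + 2 * t + 1 - m) := by
  have h := mapGL_latt_glued_corner_eq_iff_kappa hϖ hα hβ T hT h₁ h₂ h₃ (ρ := ρ) (e := 1) hρm hm (x := 1) (ζ := 1) (y'' := g) (by simp) (by simp) V hV
  rwa [mul_one, div_one] at h

end Summit.HodgeConjecture.HodgeConjecture.Cruxes.H413.F0P3cDyRamDiagonalKappaGluedDecompositionTwo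

end
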